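import Summits.AtomisticToContinuum.FouriersLaw.Theorems.EmbeddedDrudeMourreAbelThermodynamicLimitOfLowerBound

/-!
# Line `l1-tail-transport` for crux `AbelThermodynamicLimit` (item stmt-AtomisticToContinuum-12596; decl
`Summit.AtomisticToContinuum.FouriersLaw.Theses.EmbeddedDrudeMourre.AbelThermodynamicLimit`, `rfl`-equal to the
CageBudgetFekete / HoelderEscapeProfile / CoercivePulse / LatticeLandauDamping twins) — ALTERNATIVE line registered by the
crux-strategist `planner-cstrat-stmt-AtomisticToContinuum-12596-s1-0` (2026-08-17). It does NOT replace the lead's skeleton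
(`Lines/loomis_compact_horizon_witness.lean` rev 5, open exactly at the two ITEMS (R) = stmt-13416 and CLB = stmt-11749 by name);
it OPENS the item-sized stub (R) one level, along the cut that item's own birth skeleton uses
(`Cruxes/UniformAbelianRegularity/Lines/birth.lean`, planner-skel-stmt-AtomisticToContinuum-13416-0), so that a lead seated on THIS
crux has a worker-sized stub to land (`stub_equalTimeBound`, size M) whose statement is SHARED verbatim with 13416's registered stub,
and so that the two chains (12596 here, 13416 there) stay aligned on one typed residual (`stub_uniformL1Tail`).

Composition (sorry-free): `AbelThermodynamicLimit_of : S₁ → S₂ → CLB → AbelThermodynamicLimit` =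
`stub_cruxOfRegularityOfLowerBound (UniformAbelianRegularity_of S₁ S₂) CLB`, where
`UniformAbelianRegularity_of : S₁ → S₂ → StaticAbelianSqueeze.UniformAbelianRegularity` and the abstract real-analysis lemma
`abel_deficit_le` are COPIED VERBATIM (with attribution) from the 13416 birth skeleton (that module lives under `Cruxes/` and is
not built on the farm, so it cannot be imported), and `stub_cruxOfRegularityOfLowerBound : (R) → CLB → AbelThermodynamicLimit`
is the landed certificate p127832 (`Theorems/EmbeddedDrudeMourreAbelThermodynamicLimitOfLowerBound.lean`).

Stubs (3):
* `stub_equalTimeBound` (M) — `∃ C N₀ ∀ N ≥ N₀ ∀ t > 0, |c_N(t)| ≤ C·N`: kernel-invariance of `gibbsMeasure N T` under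
  `transitionKernel N T T t` (Jensen ⇒ `P_t` contracts `L²(μ_N)`, so `|c_N(t)| ≤ ‖J‖²`) + the LANDED `N`-uniform second moments
  `pinnedChain_integral_sq_bondCurrent_gibbsMeasure_le` (`Theorems/…CentralBondCurrentSecondMoments.lean`) + `Cov(j_i,j_k) = 0`
  for `|i−k| ≥ 2` (Gaussian momenta) ⇒ `‖J‖² ≤ 3MN`.
* `stub_uniformL1Tail` (XL, load-bearing; verbatim = 13416's stub 2) — `N`-uniform absolute `L¹` tail of `c_N/N`.
* `stub_conductanceLowerBound` = the ITEM `StaticAbelianSqueeze.ConductanceLowerBound` (stmt-11749) by name (as in loomis rev 5).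

Disproof used (`Cruxes/AbelThermodynamicLimit/Disproof.lean`, sha unchanged since 2026-08-16T11:13Z): `0 < γ` enters through the
steady family inside p127832 (`exists_steadyFamily_response`, honouring `tlconv_gamma_zero_false` / `conclusion_false_gamma_zero`);
`lam, β > 0` are used by `stub_uniformL1Tail` (false at the harmonic corner, `tlconv_harmonic_false`: `∫₀^∞ c_N ~ N²`); §3
`hasBoundedResponse_of_crux` is conceded — `stub_uniformL1Tail` IS an `N`-uniform bound in time-domain form. No landed Negative lemma
(`Negative/LoadBearing`, `Negative/SignLawsKillCriteria`) instantiates any stub here (no sign law, no rate is asserted).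
-/

noncomputable section

namespace Summit.AtomisticToContinuum.FouriersLaw.Cruxes.AbelThermodynamicLimit.L1TailTransport

open MeasureTheory Set

/-! ## Registered stubs -/

/-- **stub 1 — `stub_equalTimeBound`** (EARLY window: `N`-linear norm bound on the open chain's equilibrium total-current
autocorrelation; verbatim the statement of `stub_equalTimeBound` registered on stmt-AtomisticToContinuum-13416). Size M. -/
theorem stub_equalTimeBound :
    ∀ ω₂ lam β γ : ℝ, 0 < ω₂ → 0 < lam → 0 < β → 0 < γ → ∀ T : ℝ, 0 < T → ∃ C : ℝ, ∃ N₀ : ℕ, ∀ N : ℕ, N₀ ≤ N → ∀ t : ℝ, 0 < t → let J : Literature.MathematicalPhysics.KineticTheory.HeatConduction.PhaseSpace N → ℝ := fun z => ∑ i : Fin N, (Literature.MathematicalPhysics.KineticTheory.HeatConduction.pinnedChain ω₂ lam β γ).bondCurrent N i z; |∫ z, J z * (∫ y, J y ∂((Literature.MathematicalPhysics.KineticTheory.HeatConduction.pinnedChain ω₂ lam β γ).transitionKernel N T T t.toNNReal z)) ∂((Literature.MathematicalPhysics.KineticTheory.HeatConduction.pinnedChain ω₂ lam β γ).gibbsMeasure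 N T)| ≤ C * N := by
  sorry

/-- **stub 2 — `stub_uniformL1Tail`** (LATE window: `N`-uniform absolute `L¹` tail of `c_N` per unit length; verbatim the
statement of `stub_uniformL1Tail` registered on stmt-AtomisticToContinuum-13416 — the load-bearing, open-problem-class piece). Size XL. -/
theorem stub_uniformL1Tail :
    ∀ ω₂ lam β γ : ℝ, 0 < ω₂ → 0 < lam → 0 < β → 0 < γ → ∀ T : ℝ, 0 < T → ∀ ε : ℝ, 0 < ε → ∃ τ : ℝ, 0 < τ ∧ ∃ N₀ : ℕ, ∀ N : ℕ, N₀ ≤ N → let J : Literature.MathematicalPhysics.KineticTheory.HeatConduction.PhaseSpace N → ℝ := fun z => ∑ i : Fin N, (Literature.MathematicalPhysics.KineticTheory.HeatConduction.pinnedChain ω₂ lam β γ).bondCurrent N i z; MeasureTheory.IntegrableOn (fun t : ℝ => ∫ z, J z * (∫ y, J y ∂((Literature.MathematicalPhysics.KineticTheory.HeatConduction.pinnedChain ω₂ lam β γ).transitionKernel N T T t.toNNReal z)) ∂((Literature.MathematicalPhysics.KineticTheory.HeatConduction.pinnedChain ω₂ lam β γ).gibbsMeasure N T)) (Set.Ioi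 0) ∧ (∫ t in Set.Ioi τ, |∫ z, J z * (∫ y, J y ∂((Literature.MathematicalPhysics.KineticTheory.HeatConduction.pinnedChain ω₂ lam β γ).transitionKernel N T T t.toNNReal z)) ∂((Literature.MathematicalPhysics.KineticTheory.HeatConduction.pinnedChain ω₂ lam β γ).gibbsMeasure N T)|) ≤ ε * N := by
  sorry

/-- **stub 3 — `stub_conductanceLowerBound`**: the ITEM `StaticAbelianSqueeze.ConductanceLowerBound` (stmt-AtomisticToContinuum-11749)
BY NAME (positivity of the common limit; necessary for the crux at every witnessed temperature, p127832 `stub_lowerBoundOfCrux`). -/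
theorem stub_conductanceLowerBound :
    _root_.Summit.AtomisticToContinuum.FouriersLaw.Theses.StaticAbelianSqueeze.ConductanceLowerBound := by
  sorry

/-! ## Glue copied verbatim from `Cruxes/UniformAbelianRegularity/Lines/birth.lean` (planner-skel-stmt-AtomisticToContinuum-13416-0) -/

/-- **The Abel-deficit estimate, abstract form.** If `c ∈ L¹(0,∞)`, `|c| ≤ C` on `(0,∞)` and `∫_{(τ,∞)} |c| ≤ B`, then for
`ν, τ > 0`: `|∫_{(0,∞)} (1 − e^{−νt}) c(t) dt| ≤ ν τ² C + B` — split at `τ`, use `0 ≤ 1 − e^{−νt} ≤ min(νt, 1)`. [folklore] -/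
theorem abel_deficit_le {c : ℝ → ℝ} {ν τ C B : ℝ} (hν : 0 < ν) (hτ : 0 < τ) (hC : 0 ≤ C)
    (hint : IntegrableOn c (Ioi 0))
    (hbound : ∀ t : ℝ, 0 < t → |c t| ≤ C)
    (htail : (∫ t in Ioi τ, |c t|) ≤ B) :
    |∫ t in Ioi (0:ℝ), (1 - Real.exp (-(ν * t))) * c t| ≤ ν * τ ^ 2 * C + B := by
  -- the weight `w(t) = 1 - e^{-νt}`: `0 ≤ w ≤ 1` and `w(t) ≤ νt` on `(0, ∞)`
  have hw0 : ∀ t : ℝ, 0 < t → 0 ≤ 1 - Real.exp (-(ν * t)) := fun t ht => by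
    have h : Real.exp (-(ν * t)) ≤ 1 :=
      Real.exp_le_one_iff.2 (by nlinarith [mul_pos hν ht])
    linarith
  have hw1 : ∀ t : ℝ, 0 < t → 1 - Real.exp (-(ν * t)) ≤ 1 := fun t _ => by
    linarith [Real.exp_pos (-(ν * t))]
  have hwlin : ∀ t : ℝ, 0 < t → 1 - Real.exp (-(ν * t)) ≤ ν * t := fun t _ => by
    linarith [Real.add_one_le_exp (-(ν * t))]
  -- integrability of the weighted autocorrelation on `(0, ∞)`
  have hcont : Continuous fun t : ℝ => 1 - Real.exp (-(ν * t)) := by fun_prop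
  have hf_int : IntegrableOn (fun t : ℝ => (1 - Real.exp (-(ν * t))) * c t) (Ioi 0) := by
    refine Integrable.mono hint (hcont.aestronglyMeasurable.mul hint.aestronglyMeasurable) ?_
    refine (ae_restrict_iff' measurableSet_Ioi).2 (Filter.Eventually.of_forall fun t ht => ?_)
    rw [norm_mul, Real.norm_eq_abs, abs_of_nonneg (hw0 t ht)]
    exact mul_le_of_le_one_left (norm_nonneg _) (hw1 t ht)
  -- split `(0, ∞) = (0, τ] ∪ (τ, ∞)`
  have hsplit : ∫ t in Ioi (0:ℝ), (1 - Real.exp (-(ν * t))) * c t =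
      (∫ t in Ioc (0:ℝ) τ, (1 - Real.exp (-(ν * t))) * c t) +
        ∫ t in Ioi τ, (1 - Real.exp (-(ν * t))) * c t := by
    rw [← Ioc_union_Ioi_eq_Ioi hτ.le]
    exact setIntegral_union (Ioc_disjoint_Ioi le_rfl) measurableSet_Ioi
      (hf_int.mono_set Ioc_subset_Ioi_self) (hf_int.mono_set (Ioi_subset_Ioi hτ.le))
  -- EARLY piece: `‖∫_{(0,τ]} w c‖ ≤ (ν τ C) · |(0, τ]| = ν τ² C`
  have hearly : ‖∫ t in Ioc (0:ℝ) τ, (1 - Real.exp (-(ν * t))) * c t‖ ≤ ν * τ * C * τ := by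
    have h := norm_setIntegral_le_of_norm_le_const (μ := (volume : Measure ℝ)) (s := Ioc (0:ℝ) τ)
      (f := fun t : ℝ => (1 - Real.exp (-(ν * t))) * c t) (C := ν * τ * C) measure_Ioc_lt_top
      (fun t ht => by
        rw [Real.norm_eq_abs, abs_mul, abs_of_nonneg (hw0 t ht.1)]
        calc (1 - Real.exp (-(ν * t))) * |c t| ≤ (ν * t) * C :=
              mul_le_mul (hwlin t ht.1) (hbound t ht.1) (abs_nonneg _) (by nlinarith [ht.1])
          _ ≤ ν * τ * C := mul_le_mul_of_nonneg_right (mul_le_mul_of_nonneg_left ht.2 hν.le) hC)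
    rwa [Real.volume_real_Ioc_of_le hτ.le, sub_zero] at h
  -- LATE piece: `‖∫_{(τ,∞)} w c‖ ≤ ∫_{(τ,∞)} |c| ≤ B`
  have hlate : ‖∫ t in Ioi τ, (1 - Real.exp (-(ν * t))) * c t‖ ≤ B := by
    calc ‖∫ t in Ioi τ, (1 - Real.exp (-(ν * t))) * c t‖
          ≤ ∫ t in Ioi τ, ‖(1 - Real.exp (-(ν * t))) * c t‖ := norm_integral_le_integral_norm _
      _ ≤ ∫ t in Ioi τ, |c t| := by
          refine setIntegral_mono_on (hf_int.mono_set (Ioi_subset_Ioi hτ.le)).norm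
            (hint.mono_set (Ioi_subset_Ioi hτ.le)).abs measurableSet_Ioi fun t ht => ?_
          have ht0 : 0 < t := lt_trans hτ ht
          rw [norm_mul, Real.norm_eq_abs, Real.norm_eq_abs, abs_of_nonneg (hw0 t ht0)]
          exact mul_le_of_le_one_left (abs_nonneg _) (hw1 t ht0)
      _ ≤ B := htail
  -- assemble
  rw [← Real.norm_eq_abs, hsplit]
  calc ‖(∫ t in Ioc (0:ℝ) τ, (1 - Real.exp (-(ν * t))) * c t) + ∫ t in Ioi τ, (1 - Real.exp (-(ν * t))) * c t‖
        ≤ ‖∫ t in Ioc (0:ℝ) τ, (1 - Real.exp (-(ν * t))) * c t‖ + ‖∫ t in Ioi τ, (1 - Real.exp (-(ν * t))) * c t‖ :=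
          norm_add_le _ _
    _ ≤ ν * τ * C * τ + B := add_le_add hearly hlate
    _ = ν * τ ^ 2 * C + B := by ring

/-! ## The composition of the birth glue (copied verbatim) -/

/-- (copied verbatim from the 13416 birth skeleton; its docstring there: "The implication, sorry-free: stub_equalTimeBound-statement →
stub_uniformL1Tail-statement → StaticAbelianSqueeze.UniformAbelianRegularity BY NAME") -/
theorem UniformAbelianRegularity_of :
    (∀ ω₂ lam β γ : ℝ, 0 < ω₂ → 0 < lam → 0 < β → 0 < γ → ∀ T : ℝ, 0 < T → ∃ C : ℝ, ∃ N₀ : ℕ, ∀ N : ℕ, N₀ ≤ N → ∀ t : ℝ, 0 < t → let J : Literature.MathematicalPhysics.KineticTheory.HeatConduction.PhaseSpace N → ℝ := fun z => ∑ i : Fin N, (Literature.MathematicalPhysics.KineticTheory.HeatConduction.pinnedChain ω₂ lam β γ).bondCurrent N i z; |∫ z, J z * (∫ y, J y ∂((Literature.MathematicalPhysics.KineticTheory.HeatConduction.pinnedChain ω₂ lam β γ).transitionKernel N T T t.toNNReal z)) ∂((Literature.MathematicalPhysics.KineticTheory.HeatConduction.pinnedChain ω₂ lam β γ).gibbsMeasure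 N T)| ≤ C * N) →
    (∀ ω₂ lam β γ : ℝ, 0 < ω₂ → 0 < lam → 0 < β → 0 < γ → ∀ T : ℝ, 0 < T → ∀ ε : ℝ, 0 < ε → ∃ τ : ℝ, 0 < τ ∧ ∃ N₀ : ℕ, ∀ N : ℕ, N₀ ≤ N → let J : Literature.MathematicalPhysics.KineticTheory.HeatConduction.PhaseSpace N → ℝ := fun z => ∑ i : Fin N, (Literature.MathematicalPhysics.KineticTheory.HeatConduction.pinnedChain ω₂ lam β γ).bondCurrent N i z; MeasureTheory.IntegrableOn (fun t : ℝ => ∫ z, J z * (∫ y, J y ∂((Literature.MathematicalPhysics.KineticTheory.HeatConduction.pinnedChain ω₂ lam β γ).transitionKernel N T T t.toNNReal z)) ∂((Literature.MathematicalPhysics.KineticTheory.HeatConduction.pinnedChain ω₂ lam β γ).gibbsMeasure N T)) (Set.Ioi 0) ∧ (∫ t in Set.Ioi τ, |∫ z, J z * (∫ y, J y ∂((Literature.MathematicalPhysics.KineticTheory.HeatConduction.pinnedChain ω₂ lam β γ).transitionKernel N T T t.toNNReal z)) ∂((Literature.MathematicalPhysics.KineticTheory.HeatConduction.pinnedChain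 ω₂ lam β γ).gibbsMeasure N T)|) ≤ ε * N) →
    _root_.Summit.AtomisticToContinuum.FouriersLaw.Theses.StaticAbelianSqueeze.UniformAbelianRegularity := by
  intro h1 h2 ω₂ lam β γ hω hl hβ hγ T hT ε hε
  obtain ⟨C, N₁, hC⟩ := h1 ω₂ lam β γ hω hl hβ hγ T hT
  obtain ⟨τ, hτ, N₂, hL⟩ := h2 ω₂ lam β γ hω hl hβ hγ T hT (ε / 2) (half_pos hε)
  have hC' : 0 < max C 1 := lt_of_lt_of_le one_pos (le_max_right _ _)
  have hden : 0 < 2 * (max C 1 * τ ^ 2 + 1) := by positivity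
  refine ⟨ε / (2 * (max C 1 * τ ^ 2 + 1)), div_pos hε hden, fun ν hν hνlt => ⟨max N₁ N₂, fun N hN => ?_⟩⟩
  have hN1 : N₁ ≤ N := le_trans (le_max_left _ _) hN
  have hN2 : N₂ ≤ N := le_trans (le_max_right _ _) hN
  have hN0 : (0:ℝ) ≤ N := Nat.cast_nonneg N
  intro J
  have hint : MeasureTheory.IntegrableOn (fun t : ℝ => ∫ z, J z * (∫ y, J y ∂((Literature.MathematicalPhysics.KineticTheory.HeatConduction.pinnedChain ω₂ lam β γ).transitionKernel N T T t.toNNReal z)) ∂((Literature.MathematicalPhysics.KineticTheory.HeatConduction.pinnedChain ω₂ lam β γ).gibbsMeasure N T)) (Set.Ioi 0) := (hL N hN2).1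
  have htail : (∫ t in Set.Ioi τ, |∫ z, J z * (∫ y, J y ∂((Literature.MathematicalPhysics.KineticTheory.HeatConduction.pinnedChain ω₂ lam β γ).transitionKernel N T T t.toNNReal z)) ∂((Literature.MathematicalPhysics.KineticTheory.HeatConduction.pinnedChain ω₂ lam β γ).gibbsMeasure N T)|) ≤ ε / 2 * N := (hL N hN2).2
  have hbound : ∀ t : ℝ, 0 < t → |∫ z, J z * (∫ y, J y ∂((Literature.MathematicalPhysics.KineticTheory.HeatConduction.pinnedChain ω₂ lam β γ).transitionKernel N T T t.toNNReal z)) ∂((Literature.MathematicalPhysics.KineticTheory.HeatConduction.pinnedChain ω₂ lam β γ).gibbsMeasure N T)| ≤ max C 1 * N := fun t ht =>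
    le_trans (hC N hN1 t ht) (mul_le_mul_of_nonneg_right (le_max_left _ _) hN0)
  have key := abel_deficit_le (c := fun t : ℝ => ∫ z, J z * (∫ y, J y ∂((Literature.MathematicalPhysics.KineticTheory.HeatConduction.pinnedChain ω₂ lam β γ).transitionKernel N T T t.toNNReal z)) ∂((Literature.MathematicalPhysics.KineticTheory.HeatConduction.pinnedChain ω₂ lam β γ).gibbsMeasure N T)) hν hτ (mul_nonneg hC'.le hN0) hint hbound htail
  refine le_trans key ?_
  -- arithmetic: `ν τ² C' N + ε N / 2 ≤ ε N` because `ν (C' τ² + 1) < ε / 2`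
  have hν2 : ν * (2 * (max C 1 * τ ^ 2 + 1)) < ε := (lt_div_iff₀ hden).1 hνlt
  have h4 : ν * τ ^ 2 * max C 1 ≤ ε / 2 := by nlinarith [hν.le]
  have h5 : ν * τ ^ 2 * (max C 1 * (N : ℝ)) ≤ ε / 2 * N := by
    calc ν * τ ^ 2 * (max C 1 * (N : ℝ)) = (ν * τ ^ 2 * max C 1) * N := by ring
      _ ≤ ε / 2 * N := mul_le_mul_of_nonneg_right h4 hN0
  linarith


/-! ## The composition: the crux BY NAME -/

/-- **`AbelThermodynamicLimit_of`** (sorry-free): early bound → uniform `L¹` tail → ConductanceLowerBound →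
`EmbeddedDrudeMourre.AbelThermodynamicLimit`, via `UniformAbelianRegularity_of` (birth glue, copied above) and the landed certificate
`stub_cruxOfRegularityOfLowerBound` (p127832). -/
theorem AbelThermodynamicLimit_of :
    (∀ ω₂ lam β γ : ℝ, 0 < ω₂ → 0 < lam → 0 < β → 0 < γ → ∀ T : ℝ, 0 < T → ∃ C : ℝ, ∃ N₀ : ℕ, ∀ N : ℕ, N₀ ≤ N → ∀ t : ℝ, 0 < t → let J : Literature.MathematicalPhysics.KineticTheory.HeatConduction.PhaseSpace N → ℝ := fun z => ∑ i : Fin N, (Literature.MathematicalPhysics.KineticTheory.HeatConduction.pinnedChain ω₂ lam β γ).bondCurrent N i z; |∫ z, J z * (∫ y, J y ∂((Literature.MathematicalPhysics.KineticTheory.HeatConduction.pinnedChain ω₂ lam β γ).transitionKernel N T T t.toNNReal z)) ∂((Literature.MathematicalPhysics.KineticTheory.HeatConduction.pinnedChain ω₂ lam β γ).gibbsMeasure N T)| ≤ C * N) →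
    (∀ ω₂ lam β γ : ℝ, 0 < ω₂ → 0 < lam → 0 < β → 0 < γ → ∀ T : ℝ, 0 < T → ∀ ε : ℝ, 0 < ε → ∃ τ : ℝ, 0 < τ ∧ ∃ N₀ : ℕ, ∀ N : ℕ, N₀ ≤ N → let J : Literature.MathematicalPhysics.KineticTheory.HeatConduction.PhaseSpace N → ℝ := fun z => ∑ i : Fin N, (Literature.MathematicalPhysics.KineticTheory.HeatConduction.pinnedChain ω₂ lam β γ).bondCurrent N i z; MeasureTheory.IntegrableOn (fun t : ℝ => ∫ z, J z * (∫ y, J y ∂((Literature.MathematicalPhysics.KineticTheory.HeatConduction.pinnedChain ω₂ lam β γ).transitionKernel N T T t.toNNReal z)) ∂((Literature.MathematicalPhysics.KineticTheory.HeatConduction.pinnedChain ω₂ lam β γ).gibbsMeasure N T)) (Set.Ioi 0) ∧ (∫ t in Set.Ioi τ, |∫ z, J z * (∫ y, J y ∂((Literature.MathematicalPhysics.KineticTheory.HeatConduction.pinnedChain ω₂ lam β γ).transitionKernel N T T t.toNNReal z)) ∂((Literature.MathematicalPhysics.KineticTheory.HeatConduction.pinnedChain ω₂ lam β γ).gibbsMeasure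 N T)|) ≤ ε * N) →
    _root_.Summit.AtomisticToContinuum.FouriersLaw.Theses.StaticAbelianSqueeze.ConductanceLowerBound →
    _root_.Summit.AtomisticToContinuum.FouriersLaw.Theses.EmbeddedDrudeMourre.AbelThermodynamicLimit :=
  fun h1 h2 h3 =>
    _root_.Summit.AtomisticToContinuum.FouriersLaw.Theorems.AbelThermodynamicLimit.LoomisCompactHorizonWitness.stub_cruxOfRegularityOfLowerBound
      (UniformAbelianRegularity_of h1 h2) h3

/-- **Skeleton theorem** — the crux BY NAME from the three registered stubs (open exactly through their `sorryAx`). -/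
theorem AbelThermodynamicLimit_skeleton :
    _root_.Summit.AtomisticToContinuum.FouriersLaw.Theses.EmbeddedDrudeMourre.AbelThermodynamicLimit :=
  AbelThermodynamicLimit_of stub_equalTimeBound stub_uniformL1Tail stub_conductanceLowerBound

#print axioms AbelThermodynamicLimit_of

end Summit.AtomisticToContinuum.FouriersLaw.Cruxes.AbelThermodynamicLimit.L1TailTransport

end
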